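import Mathlib.GroupTheory.MonoidLocalization.GrothendieckGroup
import Mathlib.Algebra.Category.MonCat.Basic
import Mathlib.CategoryTheory.Functor.Basic
import Mathlib.CategoryTheory.Opposites
import Mathlib.CategoryTheory.Endomorphism
import Mathlib.Data.PNat.Basic
import HarnessLib

/-!
# Frobenioids I, §5: the model Frobenioid — the category of Theorem 5.2 (i)

Mochizuki, *The geometry of Frobenioids I: the general theory*, Kyushu J. Math. **62** (2008),
§5 "Model Frobenioids", Theorem 5.2 (i) (kurims text pp. 100–101)
[cite: MochizukiFrdI2008, Thm. 5.2(i) p.100].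

**Data (p. 100).** A monoid `Φ` on a category `D` (a contravariant functor to commutative monoids,
here `Φ : Dᵒᵖ ⥤ CommMonCat`, the encoding of Def. 1.1 (ii) used in this directory), a second
monoid `B` on `D` (the *rational function monoid*; in the theorem `B` is group-like and `Φ`
divisorial — neither hypothesis is needed for the construction (i)) and a homomorphism of monoids
on `D`, `Div_B : B → Φ^gp`, to the groupification of `Φ`.  "Denote the group-like monoid
determined by the image of `Div_B` by `Φ^birat ⊆ Φ^gp`."

**The category (Thm. 5.2 (i)).** Objects: pairs `(A_D, α)` with `A_D ∈ Ob(D)`, `α ∈ Φ(A_D)^gp`.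
A morphism `φ : (A_D, α) → (B_D, β)` is a collection of data (a) `deg_Fr(φ) ∈ ℕ_{≥1}`,
(b) `Base(φ) : A_D → B_D`, (c) `Div(φ) ∈ Φ(A_D)`, (d) `u_φ ∈ B(A_D)` subject to
`deg_Fr(φ) · α + Div(φ) = Φ(Base(φ))(β) + Div_B(u_φ)` in `Φ(A_D)^gp`; composition
`ψ ∘ φ = (deg_Fr(ψ) · deg_Fr(φ), Base(ψ) ∘ Base(φ), Φ(Base(φ))(Div(ψ)) + deg_Fr(ψ) · Div(φ),
B(Base(φ))(u_ψ) + deg_Fr(ψ) · u_φ)`.  "Moreover, the Frobenius degree, projection to `D`, and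
zero divisor determine a functor `C → F_Φ`."

**Dictionary.** As in `Monoids.lean` the paper's additive monoids are Lean `CommMonoid`s written
multiplicatively: `n · a ↦ a ^ n`, `a + b ↦ a * b`, `0 ↦ 1`, `M^gp ↦ Algebra.GrothendieckGroup M`.
Composition is diagrammatic in Lean (`φ ≫ ψ` is the paper's `ψ ∘ φ`).

**Contents.** `MonGp.map`/`MonGp.functor` (functoriality of `M ↦ M^gp`, §0 p. 11, so that
`monoidGp Φ = Φ ⋙ MonGp.functor` is the monoid `Φ^gp` on `D` of Def. 1.1 (ii)); `biratSubmonoid`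
(`Φ^birat`); the type `ModelFrobenioid Φ B DivB` of objects, the morphisms `ModelFrobenioid.Hom`,
the `Category` instance — the "well-defined category" of (i): the composite satisfies relation (d),
composition is associative and unital (all proved); the projection functor `baseFunctor` and the
composition laws of `Base`, `Div`, `deg_Fr` (Remark 1.1.1), which are precisely the content of
"`(deg_Fr, Base, Div)` determine a functor `C → F_Φ`".

**Not here.** Thm. 5.2 (ii)–(iv) (that this category *is a Frobenioid* of isotropic and model
type, the standard-type criteria, the comparison equivalence) are statements over the vocabulary
of Defs. 1.2–1.3 and §§3–4 and live in sibling files; the zero section `(A_D, 0)` with its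
base-Frobenius pair (proof of (iii), p. 101) is in `ModelFrobenioidSections.lean`.
TODO-merge (abc-iut-found, Def. 1.1 file): if that file defines `Φ^gp`, replace `monoidGp` by it
and package `(deg_Fr, Base, Div)` as a functor into its elementary Frobenioid `F_Φ`.
-/

noncomputable section

namespace Literature.AlgebraicGeometry.Frobenioids

open CategoryTheory Opposite

universe w v u

/-! ### Groupification of monoids on a category (`M^gp`, §0 p. 11; `Φ^gp`, Def. 1.1 (ii) p. 19) -/

namespace MonGp

variable {M N P : Type w} [CommMonoid M] [CommMonoid N] [CommMonoid P]

/-- The homomorphism `M^gp → N^gp` induced by a homomorphism of commutative monoids `M → N`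
(functoriality of the groupification `M → M^gp` of §0 p. 11, used on p. 19 to form the monoid
`Φ^gp` on `D`). [cite: MochizukiFrdI2008, Def. 1.1(ii) p.19] -/
def map (f : M →* N) : Algebra.GrothendieckGroup M →* Algebra.GrothendieckGroup N :=
  Algebra.GrothendieckGroup.lift (Algebra.GrothendieckGroup.of.comp f)

/-- `map f` extends `f`: the image of `a ∈ M` goes to the image of `f a`.
[cite: MochizukiFrdI2008, Def. 1.1(ii) p.19] -/
theorem map_of (f : M →* N) (a : M) :
    map f (Algebra.GrothendieckGroup.of a) = Algebra.GrothendieckGroup.of (f a) := by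
  have h := Algebra.GrothendieckGroup.lift.symm_apply_apply (Algebra.GrothendieckGroup.of.comp f)
  rw [Algebra.GrothendieckGroup.lift_symm_apply] at h
  exact DFunLike.congr_fun h a

/-- Two homomorphisms out of `M^gp` into a commutative group that agree on `M` are equal
(the universal property of the groupification, §0 p. 11). [cite: MochizukiFrdI2008, §0 p.11] -/
theorem hom_ext {G : Type w} [CommGroup G] {g₁ g₂ : Algebra.GrothendieckGroup M →* G}
    (h : ∀ a : M, g₁ (Algebra.GrothendieckGroup.of a) = g₂ (Algebra.GrothendieckGroup.of a)) :
    g₁ = g₂ := by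
  apply Algebra.GrothendieckGroup.lift.symm.injective
  rw [Algebra.GrothendieckGroup.lift_symm_apply, Algebra.GrothendieckGroup.lift_symm_apply]
  exact MonoidHom.ext h

/-- Functoriality: `map` of the identity is the identity. [cite: MochizukiFrdI2008, Def. 1.1(ii) p.19] -/
theorem map_id : map (MonoidHom.id M) = MonoidHom.id _ :=
  hom_ext fun a => by rw [map_of]; rfl

/-- Functoriality: `map` of a composite is the composite. [cite: MochizukiFrdI2008, Def. 1.1(ii) p.19] -/
theorem map_comp (g : N →* P) (f : M →* N) : map (g.comp f) = (map g).comp (map f) :=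
  hom_ext fun a => by rw [map_of, MonoidHom.comp_apply, MonoidHom.comp_apply, map_of, map_of]

/-- The groupification as an endofunctor of `CommMonCat`, `M ↦ M^gp`; post-composing a monoid
`Φ : Dᵒᵖ ⥤ CommMonCat` on `D` with it gives the monoid `Φ^gp` on `D` of Def. 1.1 (ii).
[cite: MochizukiFrdI2008, Def. 1.1(ii) p.19] -/
def functor : CommMonCat.{w} ⥤ CommMonCat.{w} where
  obj M := CommMonCat.of (Algebra.GrothendieckGroup M)
  map f := CommMonCat.ofHom (map f.hom)
  map_id M := by
    apply CommMonCat.hom_ext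
    rw [CommMonCat.hom_ofHom, CommMonCat.hom_id, CommMonCat.hom_id]
    exact map_id
  map_comp f g := by
    apply CommMonCat.hom_ext
    rw [CommMonCat.hom_ofHom, CommMonCat.hom_comp, CommMonCat.hom_comp, CommMonCat.hom_ofHom,
      CommMonCat.hom_ofHom]
    exact map_comp _ _

end MonGp

/-! ### The data of Theorem 5.2 and the rational function monoid `Φ^birat` -/

section Data

variable {D : Type u} [Category.{v} D]

/-- `Φ^gp`, the groupification of a monoid `Φ` on `D` (Def. 1.1 (ii), p. 19): the composite
`Φ ⋙ MonGp.functor`. [cite: MochizukiFrdI2008, Def. 1.1(ii) p.19] -/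
abbrev monoidGp (Φ : Dᵒᵖ ⥤ CommMonCat.{w}) : Dᵒᵖ ⥤ CommMonCat.{w} := Φ ⋙ MonGp.functor

variable (Φ B : Dᵒᵖ ⥤ CommMonCat.{w}) (DivB : B ⟶ monoidGp Φ)

/-- `Div_B` at `A ∈ Ob(D)` as a homomorphism `B(A) → Φ(A)^gp` (Thm. 5.2, preamble, p. 100).
[cite: MochizukiFrdI2008, Thm. 5.2 p.100] -/
def divB (A : Dᵒᵖ) : B.obj A →* Algebra.GrothendieckGroup (Φ.obj A) := (DivB.app A).hom

/-- `Φ(f) : Φ(B_D)^gp → Φ(A_D)^gp`, the transport along `f : A_D → B_D` appearing in relation (d)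
of Thm. 5.2 (i) (the value of the monoid `Φ^gp` on `f`). [cite: MochizukiFrdI2008, Thm. 5.2(i) p.100] -/
def pullGp {X Y : D} (f : X ⟶ Y) :
    Algebra.GrothendieckGroup (Φ.obj (op Y)) →* Algebra.GrothendieckGroup (Φ.obj (op X)) :=
  MonGp.map (Φ.map f.op).hom

/-- `Φ^birat(A) ⊆ Φ^gp(A)`: "the group-like monoid determined by the image of `Div_B`"
(Thm. 5.2, preamble, p. 100) — the range of `Div_B` at `A`. [cite: MochizukiFrdI2008, Thm. 5.2 p.100] -/
def biratSubmonoid (A : Dᵒᵖ) : Submonoid (Algebra.GrothendieckGroup (Φ.obj A)) :=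
  MonoidHom.mrange (divB Φ B DivB A)

variable {Φ B DivB}

/-- `pullGp` on the image of `M`: `Φ(f)(a) = Φ(f)(a)` for `a ∈ Φ(B_D)`, i.e. the transport on
`Φ^gp` extends that on `Φ`. [cite: MochizukiFrdI2008, Thm. 5.2(i) p.100] -/
theorem pullGp_of {X Y : D} (f : X ⟶ Y) (a : Φ.obj (op Y)) :
    pullGp Φ f (Algebra.GrothendieckGroup.of a) =
      Algebra.GrothendieckGroup.of ((Φ.map f.op).hom a) :=
  MonGp.map_of _ a

/-- `Φ(id) = id` on `Φ^gp`. [cite: MochizukiFrdI2008, Thm. 5.2(i) p.100] -/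
theorem pullGp_id (X : D) (c : Algebra.GrothendieckGroup (Φ.obj (op X))) :
    pullGp Φ (𝟙 X) c = c := by
  change MonGp.map (Φ.map (𝟙 (op X))).hom c = c
  rw [Φ.map_id, CommMonCat.hom_id, MonGp.map_id, MonoidHom.id_apply]

/-- `Φ(f ≫ g) = Φ(f) ∘ Φ(g)` on `Φ^gp` (contravariance). [cite: MochizukiFrdI2008, Thm. 5.2(i) p.100] -/
theorem pullGp_comp {X Y Z : D} (f : X ⟶ Y) (g : Y ⟶ Z)
    (c : Algebra.GrothendieckGroup (Φ.obj (op Z))) :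
    pullGp Φ (f ≫ g) c = pullGp Φ f (pullGp Φ g c) := by
  change MonGp.map (Φ.map (g.op ≫ f.op)).hom c = _
  rw [Φ.map_comp, CommMonCat.hom_comp, MonGp.map_comp]
  rfl

/-- Naturality of `Div_B` ("a homomorphism of monoids on `D`"): `Φ(f)(Div_B(u)) = Div_B(B(f)(u))`.
[cite: MochizukiFrdI2008, Thm. 5.2 p.100] -/
theorem pullGp_divB {X Y : D} (f : X ⟶ Y) (u : B.obj (op Y)) :
    pullGp Φ f (divB Φ B DivB (op Y) u) = divB Φ B DivB (op X) ((B.map f.op).hom u) := by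
  have h := congrArg (fun g => (CommMonCat.Hom.hom g) u) (DivB.naturality f.op)
  exact h.symm

/-- If `B(A)` is group-like (every element invertible), then `Φ^birat(A)` is closed under inverses,
so it is the group(-like monoid) "determined by the image of `Div_B`" (p. 100).
[cite: MochizukiFrdI2008, Thm. 5.2 p.100] -/
theorem inv_mem_biratSubmonoid (A : Dᵒᵖ) (hB : ∀ b : B.obj A, IsUnit b)
    {x : Algebra.GrothendieckGroup (Φ.obj A)} (hx : x ∈ biratSubmonoid Φ B DivB A) :
    x⁻¹ ∈ biratSubmonoid Φ B DivB A := by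
  obtain ⟨b, rfl⟩ := hx
  obtain ⟨u, rfl⟩ := hB b
  refine ⟨((u⁻¹ : (B.obj A)ˣ) : B.obj A), eq_inv_of_mul_eq_one_left ?_⟩
  rw [← map_mul, Units.inv_mul, map_one]

end Data

/-! ### The category of Theorem 5.2 (i) -/

section TheCategory

variable {D : Type u} [Category.{v} D]

/-- The objects of the model Frobenioid defined by the divisor monoid `Φ` and the rational function
monoid `B` (with `Div_B : B → Φ^gp`): "pairs of the form `(A_D, α)` where `A_D ∈ Ob(D)`,
`α ∈ Φ(A_D)^gp`" (Thm. 5.2 (i), p. 100). [cite: MochizukiFrdI2008, Thm. 5.2(i) p.100] -/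
structure ModelFrobenioid (Φ B : Dᵒᵖ ⥤ CommMonCat.{w}) (DivB : B ⟶ monoidGp Φ) :
    Type (max u w) where
  /-- `Base(A) := A_D`, the projection of the object to `D`. -/
  base : D
  /-- the class `α ∈ Φ(A_D)^gp`. -/
  cls : Algebra.GrothendieckGroup (Φ.obj (op base))

namespace ModelFrobenioid

variable {Φ B : Dᵒᵖ ⥤ CommMonCat.{w}} {DivB : B ⟶ monoidGp Φ}

/-- A morphism `φ : (A_D, α) → (B_D, β)` of the model Frobenioid: the data (a) `deg_Fr(φ) ∈ ℕ_{≥1}`,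
(b) `Base(φ) : A_D → B_D`, (c) `Div(φ) ∈ Φ(A) := Φ(A_D)`, (d) `u_φ ∈ B(A) := B(A_D)`, subject to
`deg_Fr(φ) · α + Div(φ) = Φ(Base(φ))(β) + Div_B(u_φ)` in `Φ(A)^gp` (Thm. 5.2 (i), p. 100;
multiplicatively `α ^ deg_Fr(φ) * Div(φ) = Φ(Base(φ))(β) * Div_B(u_φ)`).
[cite: MochizukiFrdI2008, Thm. 5.2(i) p.100] -/
@[ext]
structure Hom (X Y : ModelFrobenioid Φ B DivB) : Type (max v w) where
  /-- (a) the Frobenius degree `deg_Fr(φ) ∈ ℕ_{≥1}` -/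
  degFr : ℕ+
  /-- (b) the projection `Base(φ) : A_D → B_D` to `D` -/
  base : X.base ⟶ Y.base
  /-- (c) the zero divisor `Div(φ) ∈ Φ(A)` -/
  div : Φ.obj (op X.base)
  /-- (d) the element `u_φ ∈ B(A)` -/
  unit : B.obj (op X.base)
  /-- (d) the relation `deg_Fr(φ) · α + Div(φ) = Φ(Base(φ))(β) + Div_B(u_φ)` in `Φ(A)^gp` -/
  rel : X.cls ^ (degFr : ℕ) * Algebra.GrothendieckGroup.of div =
    pullGp Φ base Y.cls * divB Φ B DivB (op X.base) unit

/-- The identity of `(A_D, α)`: `(1, id, 0, 0)`. [cite: MochizukiFrdI2008, Thm. 5.2(i) p.100] -/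
def Hom.id (X : ModelFrobenioid Φ B DivB) : Hom X X where
  degFr := 1
  base := 𝟙 X.base
  div := 1
  unit := 1
  rel := by rw [PNat.one_coe, pow_one, map_one, mul_one, map_one, mul_one, pullGp_id]

/-- The bookkeeping behind "the composite is again a morphism": from the relations (d) for `φ` and
for `ψ` (the latter transported to `Φ(A)^gp`) to the relation (d) for `ψ ∘ φ`. [folklore] -/
private theorem comp_rel_aux {G : Type w} [CommGroup G] {x p y u q z t : G} {a b : ℕ}
    (hφ : x ^ a * p = y * u) (hψ : y ^ b * q = z * t) :
    x ^ (b * a) * (q * p ^ b) = z * (t * u ^ b) := by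
  have h1 : x ^ (b * a) * p ^ b = y ^ b * u ^ b := by
    rw [mul_comm b a, pow_mul, ← mul_pow, hφ, mul_pow]
  calc x ^ (b * a) * (q * p ^ b) = x ^ (b * a) * p ^ b * q := by rw [mul_comm q, mul_assoc]
    _ = y ^ b * q * u ^ b := by rw [h1, mul_right_comm]
    _ = z * (t * u ^ b) := by rw [hψ, mul_assoc]

/-- The composite `ψ ∘ φ := (deg_Fr(ψ) · deg_Fr(φ), Base(ψ) ∘ Base(φ),
Φ(Base(φ))(Div(ψ)) + deg_Fr(ψ) · Div(φ), B(Base(φ))(u_ψ) + deg_Fr(ψ) · u_φ)` (Thm. 5.2 (i),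
p. 100; here `Hom.comp φ ψ`, diagrammatic order).  That relation (d) holds for it is the
well-definedness asserted in (i). [cite: MochizukiFrdI2008, Thm. 5.2(i) p.100] -/
def Hom.comp {X Y Z : ModelFrobenioid Φ B DivB} (φ : Hom X Y) (ψ : Hom Y Z) : Hom X Z where
  degFr := ψ.degFr * φ.degFr
  base := φ.base ≫ ψ.base
  div := (Φ.map φ.base.op).hom ψ.div * φ.div ^ (ψ.degFr : ℕ)
  unit := (B.map φ.base.op).hom ψ.unit * φ.unit ^ (ψ.degFr : ℕ)
  rel := by
    have hψ := congrArg (pullGp Φ φ.base) ψ.rel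
    rw [map_mul, map_pow, map_mul, pullGp_of, pullGp_divB, ← pullGp_comp] at hψ
    rw [PNat.mul_coe, map_mul, map_pow, map_mul, map_pow]
    exact comp_rel_aux φ.rel hψ

/-- The model Frobenioid is a category ("a well-defined category may be constructed in the
following fashion", Thm. 5.2 (i), p. 100): the displayed composition is associative and unital.
[cite: MochizukiFrdI2008, Thm. 5.2(i) p.100] -/
instance instCategory : Category.{max v w} (ModelFrobenioid Φ B DivB) where
  Hom X Y := Hom X Y
  id X := Hom.id X
  comp φ ψ := Hom.comp φ ψ
  id_comp φ := by
    apply Hom.ext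
    · exact mul_one _
    · exact Category.id_comp _
    · change (Φ.map (𝟙 _ : _ ⟶ _).op).hom φ.div * 1 ^ (φ.degFr : ℕ) = φ.div
      rw [op_id, Φ.map_id, CommMonCat.hom_id, MonoidHom.id_apply, one_pow, mul_one]
    · change (B.map (𝟙 _ : _ ⟶ _).op).hom φ.unit * 1 ^ (φ.degFr : ℕ) = φ.unit
      rw [op_id, B.map_id, CommMonCat.hom_id, MonoidHom.id_apply, one_pow, mul_one]
  comp_id φ := by
    apply Hom.ext
    · exact one_mul _
    · exact Category.comp_id _
    · change (Φ.map φ.base.op).hom 1 * φ.div ^ ((1 : ℕ+) : ℕ) = φ.div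
      rw [map_one, one_mul, PNat.one_coe, pow_one]
    · change (B.map φ.base.op).hom 1 * φ.unit ^ ((1 : ℕ+) : ℕ) = φ.unit
      rw [map_one, one_mul, PNat.one_coe, pow_one]
  assoc φ ψ χ := by
    apply Hom.ext
    · exact (mul_assoc _ _ _).symm
    · exact Category.assoc _ _ _
    · change (Φ.map (φ.base ≫ ψ.base).op).hom χ.div *
          ((Φ.map φ.base.op).hom ψ.div * φ.div ^ (ψ.degFr : ℕ)) ^ (χ.degFr : ℕ) =
        (Φ.map φ.base.op).hom ((Φ.map ψ.base.op).hom χ.div * ψ.div ^ (χ.degFr : ℕ)) *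
          φ.div ^ ((χ.degFr * ψ.degFr : ℕ+) : ℕ)
      rw [op_comp, Φ.map_comp, CommMonCat.comp_apply, map_mul, map_pow, mul_pow, ← pow_mul,
        PNat.mul_coe, mul_assoc, mul_comm (ψ.degFr : ℕ)]
    · change (B.map (φ.base ≫ ψ.base).op).hom χ.unit *
          ((B.map φ.base.op).hom ψ.unit * φ.unit ^ (ψ.degFr : ℕ)) ^ (χ.degFr : ℕ) =
        (B.map φ.base.op).hom ((B.map ψ.base.op).hom χ.unit * ψ.unit ^ (χ.degFr : ℕ)) *
          φ.unit ^ ((χ.degFr * ψ.degFr : ℕ+) : ℕ)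
      rw [op_comp, B.map_comp, CommMonCat.comp_apply, map_mul, map_pow, mul_pow, ← pow_mul,
        PNat.mul_coe, mul_assoc, mul_comm (ψ.degFr : ℕ)]

/-! ### `Base`, `Div`, `deg_Fr` and their composition laws (the functor to `F_Φ`) -/

section Projections

variable {X Y Z : ModelFrobenioid Φ B DivB}

/-- `deg_Fr(φ)` of a morphism of the category. [cite: MochizukiFrdI2008, Thm. 5.2(i) p.100] -/
abbrev degFr (φ : X ⟶ Y) : ℕ+ := Hom.degFr φ

/-- `Base(φ)` of a morphism of the category. [cite: MochizukiFrdI2008, Thm. 5.2(i) p.100] -/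
abbrev baseMap (φ : X ⟶ Y) : X.base ⟶ Y.base := Hom.base φ

/-- `Div(φ)` of a morphism of the category. [cite: MochizukiFrdI2008, Thm. 5.2(i) p.100] -/
abbrev div (φ : X ⟶ Y) : Φ.obj (op X.base) := Hom.div φ

/-- `u_φ` of a morphism of the category. [cite: MochizukiFrdI2008, Thm. 5.2(i) p.100] -/
abbrev unit (φ : X ⟶ Y) : B.obj (op X.base) := Hom.unit φ

/-- Extensionality for morphisms of the category: a morphism is determined by the data (a)–(d).
[cite: MochizukiFrdI2008, Thm. 5.2(i) p.100] -/
@[ext]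
theorem hom_ext {φ ψ : X ⟶ Y} (h₁ : degFr φ = degFr ψ) (h₂ : baseMap φ = baseMap ψ)
    (h₃ : div φ = div ψ) (h₄ : unit φ = unit ψ) : φ = ψ :=
  Hom.ext h₁ h₂ h₃ h₄

/-- The relation (d) of a morphism: `deg_Fr(φ) · α + Div(φ) = Φ(Base(φ))(β) + Div_B(u_φ)`.
[cite: MochizukiFrdI2008, Thm. 5.2(i) p.100] -/
theorem rel (φ : X ⟶ Y) :
    X.cls ^ (degFr φ : ℕ) * Algebra.GrothendieckGroup.of (div φ) =
      pullGp Φ (baseMap φ) Y.cls * divB Φ B DivB (op X.base) (unit φ) :=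
  Hom.rel φ

/-- `deg_Fr(id) = 1`. [cite: MochizukiFrdI2008, Thm. 5.2(i) p.100] -/
@[simp] theorem degFr_id : degFr (𝟙 X) = 1 := rfl

/-- `Base(id) = id`. [cite: MochizukiFrdI2008, Thm. 5.2(i) p.100] -/
@[simp] theorem baseMap_id : baseMap (𝟙 X) = 𝟙 X.base := rfl

/-- `Div(id) = 0`. [cite: MochizukiFrdI2008, Thm. 5.2(i) p.100] -/
@[simp] theorem div_id : div (𝟙 X) = 1 := rfl

/-- `u_{id} = 0`. [cite: MochizukiFrdI2008, Thm. 5.2(i) p.100] -/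
@[simp] theorem unit_id : unit (𝟙 X) = 1 := rfl

/-- `deg_Fr(ψ ∘ φ) = deg_Fr(ψ) · deg_Fr(φ)` (Thm. 5.2 (i); Remark 1.1.1).
[cite: MochizukiFrdI2008, Thm. 5.2(i) p.100] -/
@[simp] theorem degFr_comp (φ : X ⟶ Y) (ψ : Y ⟶ Z) : degFr (φ ≫ ψ) = degFr ψ * degFr φ := rfl

/-- `Base(ψ ∘ φ) = Base(ψ) ∘ Base(φ)` (Thm. 5.2 (i); Remark 1.1.1).
[cite: MochizukiFrdI2008, Thm. 5.2(i) p.100] -/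
@[simp] theorem baseMap_comp (φ : X ⟶ Y) (ψ : Y ⟶ Z) :
    baseMap (φ ≫ ψ) = baseMap φ ≫ baseMap ψ := rfl

/-- `Div(ψ ∘ φ) = Φ(Base(φ))(Div(ψ)) + deg_Fr(ψ) · Div(φ)` (Thm. 5.2 (i); Remark 1.1.1).
[cite: MochizukiFrdI2008, Thm. 5.2(i) p.100] -/
@[simp] theorem div_comp (φ : X ⟶ Y) (ψ : Y ⟶ Z) :
    div (φ ≫ ψ) = (Φ.map (baseMap φ).op).hom (div ψ) * div φ ^ (degFr ψ : ℕ) := rfl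

/-- `u_{ψ ∘ φ} = B(Base(φ))(u_ψ) + deg_Fr(ψ) · u_φ` (Thm. 5.2 (i)).
[cite: MochizukiFrdI2008, Thm. 5.2(i) p.100] -/
@[simp] theorem unit_comp (φ : X ⟶ Y) (ψ : Y ⟶ Z) :
    unit (φ ≫ ψ) = (B.map (baseMap φ).op).hom (unit ψ) * unit φ ^ (degFr ψ : ℕ) := rfl

variable (Φ B DivB) in
/-- The natural projection functor to `D`: `(A_D, α) ↦ A_D`, `φ ↦ Base(φ)` (Thm. 5.2 (i)).
[cite: MochizukiFrdI2008, Thm. 5.2(i) p.100] -/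
def baseFunctor : ModelFrobenioid Φ B DivB ⥤ D where
  obj X := X.base
  map φ := baseMap φ

/-- The Frobenius degree is a homomorphism of monoids `End(A) → ℕ_{≥1}` (`deg_Fr(id) = 1` and
multiplicativity; `ℕ_{≥1}` being commutative, the order convention of `End` is immaterial).
[cite: MochizukiFrdI2008, Thm. 5.2(i) p.100] -/
def degFrHom (X : ModelFrobenioid Φ B DivB) : End X →* ℕ+ where
  toFun φ := degFr φ
  map_one' := rfl
  map_mul' φ ψ := by
    change degFr (ψ ≫ φ) = degFr φ * degFr ψ
    rfl

end Projections

end ModelFrobenioid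

end TheCategory

end Literature.AlgebraicGeometry.Frobenioids
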